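import Literature.Barriers.NavierStokesRegularity.NavierStokesInequalityArrangement
import Literature.Analysis.FluidPDE.NormalisedPressureIsometry
import Literature.Analysis.FluidPDE.AxisymmetricReflection
import HarnessLib

/-!
# Symmetries of `u[v,f]` and of its pressure (Ożański 2017, §3.3: axisymmetry, Lemma 3.2 (i))

Barrier catalogue support file for `NavierStokesRegularity` (D-0021), on the decomposition path
of `Literature.Barriers.NavierStokesRegularity.NSIBlock_of_arrangement` (fact D of
`NavierStokesInequalityArrangement`; Ożański, arXiv:1709.00602v4, §4). The proof of
Proposition 4.2 there uses, for the fields `u[v,f]` ((3.10)–(3.12)) and their pressure functions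
`p*[v,f]` (3.19), `p[v,f] = p*[v,f](·,·,0)` (3.20):

* `u[v,f]` is axisymmetric (§3.3: "`u[v,f]` … the axisymmetric vector field satisfying (3.10)"),
  hence so is `p*[v,f]` (after (3.21): "since `u[v,f]` is axisymmetric, the same is true of
  `p*[v,f]`", by (3.8)) — `isAxisymmetric_swirlField`,
  `isAxisymmetricScalar_normalisedPressure_swirlField`;
* Lemma 3.2 (i): `p[v,f] = p[-v,f]` — `planePressure_neg`, hence `F[-v,f] = F[v,f]`
  (`pressureInteraction_neg`; used with the oscillatory processes, Theorem 4.3, through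
  `F_{i,l}(x,t,-1) = F_{i,l}(x,t,1)`);
* the remark after Definition 3.3: `(av, f, φ)` is a structure for `|a| ≤ 1` whenever `(v,f,φ)`
  is ((4.20)) — `IsNSIStructure.smul`.

## Proof of Lemma 3.2 (i) (a symmetry argument replacing the coordinate computation (3.27))

Let `σ` be the reflection in the meridian plane (`FluidPDE.reflY`, `(x₀,x₁,x₂) ↦ (x₀,-x₁,x₂)`): it
fixes the meridian plane pointwise, preserves the meridian coordinates, maps `ρ̂ ↦ σρ̂`, and
reverses the swirl direction, so that `σ ∘ u[v,f] ∘ σ = -u[-v,f]` (`swirlField_neg_eq`). The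
normalised pressure is quadratic (`normalisedPressure_smul`, `p̃[-u] = p̃[u]`) and covariant
under linear isometries (`normalisedPressure_conj_linearIsometryEquiv`,
`p̃[σ ∘ u ∘ σ⁻¹] = p̃[u] ∘ σ⁻¹`), whence `p*[-v,f] = p*[v,f] ∘ σ` and, on the mirror,
`p[-v,f] = p[v,f]`. (Ożański proves it from the table (3.27) of `∂ᵢuⱼ`, observing that
`Σ ∂ᵢuⱼ∂ⱼuᵢ` is even in `v`.)

## References

* W. S. Ożański, arXiv:1709.00602v4, §3.3 ((3.8), (3.10)–(3.12), (3.19)–(3.21)), Lemma 3.2 (i),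
  remark after Definition 3.3, (4.20). [`Ozanski2017NSISingular`] (The held plain-text
  rendering numbers Lemma 3.2 as "Lemma 4" and Definition 3.3 as "Definition 5".)
-/

noncomputable section

open MeasureTheory Set Function Filter Topology TopologicalSpace WithLp Metric
open scoped ENNReal InnerProductSpace RealInnerProductSpace ContDiff

namespace Literature.Barriers.NavierStokesRegularity

open Literature.Analysis.FluidPDE

variable (v : ℝ × ℝ → ℝ × ℝ) (f : ℝ × ℝ → ℝ)

/-! ### Axisymmetry of `u[v,f]` and of `p*[v,f]` -/

/-- The meridian coordinates are invariant under the rotations about the axis. [folklore] -/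
theorem meridian_rotZ (θ : ℝ) (x : EuclideanSpace ℝ (Fin 3)) :
    meridian (rotZ θ x) = meridian x := by
  simp [meridian, cylRadius_rotZ]

/-- The radial frame vector is equivariant: `ρ̂(R_θ x) = R_θ ρ̂(x)`. [folklore] -/
theorem eR_rotZ_eq (θ : ℝ) (x : EuclideanSpace ℝ (Fin 3)) :
    eR (rotZ θ x) = rotZ θ (eR x) := by
  ext i
  fin_cases i <;> simp [eR, cylRadius_rotZ] <;> ring

/-- The angular frame vector is equivariant: `φ̂(R_θ x) = R_θ φ̂(x)`. [folklore] -/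
theorem eTheta_rotZ_eq (θ : ℝ) (x : EuclideanSpace ℝ (Fin 3)) :
    eTheta (rotZ θ x) = rotZ θ (eTheta x) := by
  ext i
  fin_cases i <;> simp [eTheta, cylRadius_rotZ] <;> ring

/-- The axial frame vector is fixed: `R_θ x̂_axis = x̂_axis`. [folklore] -/
theorem rotZ_eZ (θ : ℝ) : rotZ θ eZ = eZ := by
  ext i
  fin_cases i <;> simp [eZ, rotZ]

/-- **`u[v,f]` is axisymmetric**: `u[v,f](R_θ x) = R_θ u[v,f](x)` (Ożański §3.3: `u[v,f]` is "the
axisymmetric vector field satisfying (3.10)"; here by equivariance of the frame `ρ̂, φ̂, x̂_axis`).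
[cite: Ozanski2017NSISingular, §3.3 (3.10)–(3.12)] -/
theorem isAxisymmetric_swirlField : IsAxisymmetric (swirlField v f) := by
  intro θ x
  rw [swirlField, swirlField, meridian_rotZ, eR_rotZ_eq, eTheta_rotZ_eq]
  conv_rhs => rw [← rotZLIE_apply, map_add, map_add, map_smul, map_smul, map_smul, rotZLIE_apply,
    rotZLIE_apply, rotZLIE_apply, rotZ_eZ]

/-- **`p*[v,f]` is axisymmetric** (Ożański, after (3.21): "since `u[v,f]` is axisymmetric, the same
is true of `p*[v,f]`", by (3.8)). [cite: Ozanski2017NSISingular, §3.3 (3.21) and (3.8)] -/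
theorem isAxisymmetricScalar_normalisedPressure_swirlField :
    IsAxisymmetricScalar (normalisedPressure (swirlField v f)) := fun θ x =>
  normalisedPressure_comp_linearIsometryEquiv_of_equivariant (rotZLIE θ)
    (fun y => isAxisymmetric_swirlField v f θ y) x

/-! ### The reflection in the meridian plane and Lemma 3.2 (i) -/

/-- The meridian coordinates are invariant under the reflection `σ` in the meridian plane.
[folklore] -/
theorem meridian_reflY (x : EuclideanSpace ℝ (Fin 3)) : meridian (reflY x) = meridian x := by
  simp [meridian, cylRadius_reflY]

/-- The reflection fixes the meridian plane pointwise. [folklore] -/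
@[simp] theorem reflY_meridianPoint (q : ℝ × ℝ) : reflY (meridianPoint q) = meridianPoint q := by
  ext i
  fin_cases i <;> simp [meridianPoint, reflY]

/-- `ρ̂(σx) = σρ̂(x)`. [folklore] -/
theorem eR_reflY (x : EuclideanSpace ℝ (Fin 3)) : eR (reflY x) = reflY (eR x) := by
  ext i
  fin_cases i <;> simp [eR, cylRadius_reflY]

/-- `φ̂(σx) = -σφ̂(x)`: the mirror reverses the swirl direction. [folklore] -/
theorem eTheta_reflY (x : EuclideanSpace ℝ (Fin 3)) :
    eTheta (reflY x) = -reflY (eTheta x) := by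
  ext i
  fin_cases i <;> simp [eTheta, cylRadius_reflY]

/-- `σ x̂_axis = x̂_axis`. [folklore] -/
theorem reflY_eZ : reflY eZ = eZ := by
  ext i
  fin_cases i <;> simp [eZ, reflY]

/-- **Reversing the poloidal part is conjugation by the mirror, up to sign**:
`u[-v,f](x) = -σ(u[v,f](σ x))`. [folklore] -/
theorem swirlField_neg_eq (x : EuclideanSpace ℝ (Fin 3)) :
    swirlField (-v) f x = -reflY (swirlField v f (reflY x)) := by
  rw [swirlField, swirlField, meridian_reflY, eR_reflY, eTheta_reflY, map_add, map_add, map_smul,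
    map_smul, map_smul, map_neg, reflY_reflY, reflY_reflY, reflY_eZ]
  simp only [Pi.neg_apply, Prod.fst_neg, Prod.snd_neg, neg_sq, smul_neg, neg_add_rev, neg_neg,
    neg_smul]
  abel

/-- **Lemma 3.2 (i): `p[v,f] = p[-v,f]`** — the planar pressure does not see the orientation of
the poloidal part (here for all planar `v`, `f`: `p̃` is quadratic and isometry covariant, and the
mirror `σ` fixes the meridian plane). [cite: Ozanski2017NSISingular, Lemma 3.2 (i)] -/
theorem planePressure_neg : planePressure (-v) f = planePressure v f := by
  funext q
  have h1 : swirlField (-v) f = (-1 : ℝ) • fun x => reflY (swirlField v f (reflY.symm x)) := by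
    funext x
    rw [swirlField_neg_eq, reflY_symm, Pi.smul_apply, neg_one_smul]
  rw [planePressure, planePressure, h1, normalisedPressure_smul,
    normalisedPressure_conj_linearIsometryEquiv, reflY_symm, reflY_meridianPoint]
  norm_num

/-- **`F[-v,f] = F[v,f]`** (from Lemma 3.2 (i); this is the symmetry
`F_{i,l}(x,t,-1) = F_{i,l}(x,t,1)` fed to Theorem 4.3).
[cite: Ozanski2017NSISingular, Lemma 3.2 (i)] -/
theorem pressureInteraction_neg : pressureInteraction (-v) f = pressureInteraction v f := by
  funext q
  rw [pressureInteraction, pressureInteraction, planePressure_neg]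

/-! ### Rescaling the poloidal part of a structure -/

namespace IsNSIStructure

variable {U : Set (ℝ × ℝ)} {v} {f} {φ : ℝ × ℝ → ℝ}

/-- **`(av, f, φ)` is a structure for `|a| ≤ 1` whenever `(v, f, φ)` is** (Ożański, remark after
Definition 3.3, used as (4.20)).
[cite: Ozanski2017NSISingular, Definition 3.3 (remark) and (4.20)] -/
theorem smul (h : IsNSIStructure U v f φ) {a : ℝ} (ha : |a| ≤ 1) :
    IsNSIStructure U (a • v) f φ where
  isOpen := h.isOpen
  isCompact_closure := h.isCompact_closure
  closure_subset := h.closure_subset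
  v_smooth := h.v_smooth.const_smul a
  f_smooth := h.f_smooth
  φ_smooth := h.φ_smooth
  f_nonneg := h.f_nonneg
  φ_mem := h.φ_mem
  tsupport_f := h.tsupport_f
  tsupport_φ := h.tsupport_φ
  tsupport_v := (tsupport_smul_subset_right (fun _ : ℝ × ℝ => a) v).trans h.tsupport_v
  div_eq_zero q hq := by
    have h1 : (fun q' : ℝ × ℝ => q'.1 * ((a • v) q').1) = fun q' => a * (q'.1 * (v q').1) := by
      funext q'; simp; ring
    have h2 : (fun q' : ℝ × ℝ => q'.1 * ((a • v) q').2) = fun q' => a * (q'.1 * (v q').2) := by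
      funext q'; simp; ring
    have key := h.div_eq_zero q hq
    have hv : Differentiable ℝ v := h.v_smooth.differentiable (by simp)
    have hd1 : DifferentiableAt ℝ (fun q' : ℝ × ℝ => q'.1 * (v q').1) q := by fun_prop
    have hd2 : DifferentiableAt ℝ (fun q' : ℝ × ℝ => q'.1 * (v q').2) q := by fun_prop
    simp only [derivR, derivZ] at key ⊢
    rw [h1, h2, fderiv_const_mul hd1, fderiv_const_mul hd2]
    simp only [FunLike.coe_smul, Pi.smul_apply, smul_eq_mul]
    linear_combination a * key
  sq_lt q hq := by
    have hv := h.sq_lt q hq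
    have ha2 : a ^ 2 ≤ 1 := by
      have := abs_le.1 ha
      nlinarith
    have hnn : 0 ≤ (v q).1 ^ 2 + (v q).2 ^ 2 := by positivity
    calc ((a • v) q).1 ^ 2 + ((a • v) q).2 ^ 2 = a ^ 2 * ((v q).1 ^ 2 + (v q).2 ^ 2) := by
          simp; ring
      _ ≤ 1 * ((v q).1 ^ 2 + (v q).2 ^ 2) := mul_le_mul_of_nonneg_right ha2 hnn
      _ < f q ^ 2 := by rw [one_mul]; exact hv
  opL_pos := h.opL_pos

/-- `(-v, f, φ)` is a structure whenever `(v, f, φ)` is.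
[cite: Ozanski2017NSISingular, Definition 3.3 (remark)] -/
theorem neg (h : IsNSIStructure U v f φ) : IsNSIStructure U (-v) f φ := by
  have := h.smul (a := -1) (by norm_num)
  rwa [neg_one_smul] at this

end IsNSIStructure

end Literature.Barriers.NavierStokesRegularity
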